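import Literature.NumberTheory.EllipticCurves.PAdicMeasureMomentFiltration
import Mathlib.NumberTheory.Padics.MahlerBasis
import HarnessLib

/-!
# A bounded `p`-adic distribution on `ℤ_p` is determined by its moments

For `μ ∈ 𝔻(ℤ_p, ℚ_p)` (bounded distribution = measure, `PAdicDistributionModule`) with all moments
`m_j(μ) = ∫ z^j dμ = 0` we prove `μ = 0` (`eq_zero_of_forall_moment_eq_zero`).  Proof: the binomial
polynomials `C(z, n)` are `ℚ`-combinations of monomials (`n! · C(z,n) = z(z-1)⋯(z-n+1)`,
`Ring.descPochhammer_eq_factorial_smul_choose`), so `∫ C(z,n) dμ = 0` (`integral_mahler_eq_zero`); by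
**Mahler's theorem** (Mathlib `PadicInt.hasSum_mahler`) every continuous `f : ℤ_p → ℤ_p`, in
particular the indicator of a residue class, is a uniform limit of finite Mahler sums, so
`∫ f dμ = 0` (`integral_continuousMap_eq_zero`) and all level data `μ_n(a) = ∫ 1_{a + p^n ℤ_p} dμ`
vanish.  Consequence used by the control theorem: a measure lying in every step of Greenberg's
filtration `F^N 𝔻⁰_k` is zero (`eq_zero_of_forall_mem_filG`).

Brick B2l-a of the bottom-up plan recorded with the named fact
`greenbergStevens_kitagawa_twoVariable_interpolation_allBranches`.  Everything is proved; no named facts.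

## References

* K. Mahler, *An interpolation series for continuous functions of a p-adic variable*, J. reine angew.
  Math. 199 (1958); Mathlib `Mathlib.NumberTheory.Padics.MahlerBasis`. [folklore]
* M. Greenberg, Israel J. Math. 161 (2007), proof of Thm. 9 (injectivity). [Greenberg2007Lifting]
-/

noncomputable section

open Filter Topology Polynomial

namespace Literature.NumberTheory.EllipticCurves

variable {p : ℕ} [Fact p.Prime]

open BoundedDistribution

/-! ### Integrals of integer polynomials and of the Mahler basis -/

/-- An integer polynomial, evaluated in `ℤ_p` and read in `ℚ_p`, is a finite combination of monomials.
[folklore] -/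
theorem coe_smeval_eq_sum (P : ℤ[X]) (z : ℤ_[p]) :
    ((P.smeval z : ℤ_[p]) : ℚ_[p]) = ∑ i ∈ P.support, ((P.coeff i : ℤ) : ℚ_[p]) * (z : ℚ_[p]) ^ i := by
  rw [Polynomial.smeval_eq_sum, Polynomial.sum_def, PadicInt.coe_sum]
  refine Finset.sum_congr rfl fun i _ => ?_
  rw [Polynomial.smul_pow, zsmul_eq_mul, PadicInt.coe_mul, PadicInt.coe_pow, PadicInt.coe_intCast]

/-- **`∫ P(z) dμ = 0` for every integer polynomial `P` when all moments of `μ` vanish.** [folklore] -/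
theorem integral_smeval_eq_zero (D : BoundedDistribution (ProfiniteTower.padicInt p) ℚ_[p])
    (hm : ∀ j : ℕ, D.integral (fun z : ℤ_[p] => (z : ℚ_[p]) ^ j) = 0) (P : ℤ[X]) :
    D.integral (fun z : ℤ_[p] => ((P.smeval z : ℤ_[p]) : ℚ_[p])) = 0 := by
  simp_rw [coe_smeval_eq_sum]
  rw [D.integral_finset_sum _ fun i _ => CompactSpace.uniformContinuous_of_continuous (by fun_prop)]
  refine Finset.sum_eq_zero fun i _ => ?_
  rw [D.integral_const_mul _ (uniformContinuous_coe_pow i), hm i, mul_zero]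

/-- **`∫ C(z, n) dμ = 0` when all moments of `μ` vanish** (`n! C(z,n)` is an integer polynomial in `z`).
[folklore] -/
theorem integral_mahler_eq_zero (D : BoundedDistribution (ProfiniteTower.padicInt p) ℚ_[p])
    (hm : ∀ j : ℕ, D.integral (fun z : ℤ_[p] => (z : ℚ_[p]) ^ j) = 0) (n : ℕ) :
    D.integral (fun z : ℤ_[p] => ((mahler n z : ℤ_[p]) : ℚ_[p])) = 0 := by
  have hfac : (n.factorial : ℚ_[p]) ≠ 0 := by exact_mod_cast n.factorial_ne_zero
  have hrel : (fun z : ℤ_[p] => ((mahler n z : ℤ_[p]) : ℚ_[p])) =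
      fun z => (n.factorial : ℚ_[p])⁻¹ * (((descPochhammer ℤ n).smeval z : ℤ_[p]) : ℚ_[p]) := by
    funext z
    rw [mahler_apply, Ring.descPochhammer_eq_factorial_smul_choose, nsmul_eq_mul, PadicInt.coe_mul, PadicInt.coe_natCast,
      ← mul_assoc, inv_mul_cancel₀ hfac, one_mul]
  have huc : UniformContinuous fun z : ℤ_[p] => (((descPochhammer ℤ n).smeval z : ℤ_[p]) : ℚ_[p]) := by
    have h : (fun z : ℤ_[p] => (((descPochhammer ℤ n).smeval z : ℤ_[p]) : ℚ_[p])) =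
        fun z : ℤ_[p] => ∑ i ∈ (descPochhammer ℤ n).support, (((descPochhammer ℤ n).coeff i : ℤ) : ℚ_[p]) * (z : ℚ_[p]) ^ i :=
      funext (coe_smeval_eq_sum _)
    rw [h]
    exact CompactSpace.uniformContinuous_of_continuous (by fun_prop)
  rw [hrel, D.integral_const_mul _ huc, integral_smeval_eq_zero D hm, mul_zero]

/-! ### Mahler's theorem: all integrals of continuous functions vanish -/

/-- **If all moments of `μ` vanish then `∫ f dμ = 0` for every continuous `f : ℤ_p → ℤ_p`** (Mahler
expansion `f = Σ aₙ C(·,n)`, uniformly convergent). [folklore] -/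
theorem integral_continuousMap_eq_zero (D : BoundedDistribution (ProfiniteTower.padicInt p) ℚ_[p])
    (hm : ∀ j : ℕ, D.integral (fun z : ℤ_[p] => (z : ℚ_[p]) ^ j) = 0) (f : C(ℤ_[p], ℤ_[p])) :
    D.integral (fun z : ℤ_[p] => (f z : ℚ_[p])) = 0 := by
  -- partial Mahler sums
  set a : ℕ → ℤ_[p] := fun n => (fwdDiff (1 : ℤ_[p]))^[n] f 0 with ha
  set S : ℕ → C(ℤ_[p], ℤ_[p]) := fun k => ∑ n ∈ Finset.range k, PadicInt.mahlerTerm (a n) n with hS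
  have hlim : Tendsto S atTop (𝓝 f) := (PadicInt.hasSum_mahler f).tendsto_sum_nat
  -- the error sequence `‖S_k − f‖ → 0` bounds the pointwise errors
  set e : ℕ → ℝ := fun k => ‖S k - f‖ with he
  have he0 : Tendsto e atTop (𝓝 0) := tendsto_iff_norm_sub_tendsto_zero.mp hlim
  have hF : ∀ k, UniformContinuous fun z : ℤ_[p] => ((S k z : ℤ_[p]) : ℚ_[p]) := fun k =>
    CompactSpace.uniformContinuous_of_continuous (continuous_subtype_val.comp (S k).continuous)
  have hf : UniformContinuous fun z : ℤ_[p] => ((f z : ℤ_[p]) : ℚ_[p]) :=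
    CompactSpace.uniformContinuous_of_continuous (continuous_subtype_val.comp f.continuous)
  have hbound : ∀ k z, ‖((S k z : ℤ_[p]) : ℚ_[p]) - ((f z : ℤ_[p]) : ℚ_[p])‖ ≤ e k := fun k z => by
    rw [← PadicInt.coe_sub, PadicInt.padic_norm_e_of_padicInt, ← ContinuousMap.sub_apply]
    exact ContinuousMap.norm_coe_le_norm (S k - f) z
  have hconv := D.tendsto_integral_of_forall_norm_sub_le hF hf (fun k => norm_nonneg _) hbound he0
  -- each `∫ S_k dμ` vanishes
  have hSk : ∀ k, D.integral (fun z : ℤ_[p] => ((S k z : ℤ_[p]) : ℚ_[p])) = 0 := fun k => by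
    have hexp : (fun z : ℤ_[p] => ((S k z : ℤ_[p]) : ℚ_[p])) =
        fun z : ℤ_[p] => ∑ n ∈ Finset.range k, ((mahler n z : ℤ_[p]) : ℚ_[p]) * ((a n : ℤ_[p]) : ℚ_[p]) := by
      funext z
      rw [hS]
      simp only [ContinuousMap.coe_sum, Finset.sum_apply, PadicInt.mahlerTerm_apply, smul_eq_mul, PadicInt.coe_sum,
        PadicInt.coe_mul]
    have huc : ∀ n : ℕ, UniformContinuous fun z : ℤ_[p] => ((mahler n z : ℤ_[p]) : ℚ_[p]) := fun n =>
      CompactSpace.uniformContinuous_of_continuous (continuous_subtype_val.comp (mahler (p := p) n).continuous)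
    have huc' : ∀ n : ℕ, UniformContinuous fun z : ℤ_[p] => ((mahler n z : ℤ_[p]) : ℚ_[p]) * ((a n : ℤ_[p]) : ℚ_[p]) :=
      fun n => CompactSpace.uniformContinuous_of_continuous
        ((continuous_subtype_val.comp (mahler (p := p) n).continuous).mul continuous_const)
    rw [hexp, D.integral_finset_sum (Finset.range k)
      (f := fun n z => ((mahler n z : ℤ_[p]) : ℚ_[p]) * ((a n : ℤ_[p]) : ℚ_[p])) (fun n _ => huc' n)]
    refine Finset.sum_eq_zero fun n _ => ?_
    rw [D.integral_mul_const _ (huc n), integral_mahler_eq_zero D hm n, zero_mul]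
  have h0 : Tendsto (fun k => D.integral (fun z : ℤ_[p] => ((S k z : ℤ_[p]) : ℚ_[p]))) atTop (𝓝 0) := by
    simp only [hSk]; exact tendsto_const_nhds
  exact tendsto_nhds_unique hconv h0

/-! ### Moments determine the measure -/

/-- The indicator of a residue class modulo `p^n` as a continuous map `ℤ_p → ℤ_p`. [folklore] -/
def indCM (n : ℕ) (a : ZMod (p ^ n)) : C(ℤ_[p], ℤ_[p]) :=
  ⟨fun z => if PadicInt.toZModPow n z = a then 1 else 0,
    (uniformContinuous_comp_toZModPow n (fun t : ZMod (p ^ n) => if t = a then (1 : ℤ_[p]) else 0)).continuous⟩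

/-- The `ℚ_p`-valued cell indicator is the coercion of `indCM`. [folklore] -/
theorem cellInd_eq_coe_indCM (n : ℕ) (a : ZMod (p ^ n)) (z : ℤ_[p]) :
    cellInd (𝕜 := ℚ_[p]) n a z = ((indCM n a z : ℤ_[p]) : ℚ_[p]) := by
  rw [cellInd_apply]
  change (if PadicInt.toZModPow n z = a then (1 : ℚ_[p]) else 0) =
    (((if PadicInt.toZModPow n z = a then (1 : ℤ_[p]) else 0 : ℤ_[p])) : ℚ_[p])
  split_ifs <;> simp

/-- **A bounded distribution on `ℤ_p` all of whose moments vanish is zero** (Mahler). [folklore] -/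
theorem eq_zero_of_forall_moment_eq_zero (μ : (ProfiniteTower.padicInt p).distributions ℚ_[p])
    (hm : ∀ j : ℕ, moment μ.1 j = 0) : μ = 0 := by
  set D := ProfiniteTower.toBounded μ.2 with hD
  have hm' : ∀ j : ℕ, D.integral (fun z : ℤ_[p] => (z : ℚ_[p]) ^ j) = 0 := hm
  refine Subtype.ext (funext fun n => funext fun a => ?_)
  have h1 : μ.1 n a = D.integral (cellInd n a) := (D.integral_cellInd n a).symm
  have h2 : (cellInd (𝕜 := ℚ_[p]) n a) = fun z => ((indCM n a z : ℤ_[p]) : ℚ_[p]) := funext (cellInd_eq_coe_indCM n a)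
  change μ.1 n a = 0
  rw [h1, h2, integral_continuousMap_eq_zero D hm' (indCM n a)]

/-- **Greenberg's filtration is separated**: a measure in every `F^N 𝔻⁰_k` is zero (all its moments
vanish). [cite: Greenberg2007Lifting, §4] -/
theorem eq_zero_of_forall_mem_filG {k : ℕ} (μ : (ProfiniteTower.padicInt p).distributions ℚ_[p])
    (h : ∀ N : ℕ, μ.1 ∈ filG p k N) : μ = 0 := by
  have hp1 : (1 : ℝ) < p := by exact_mod_cast (Fact.out : p.Prime).one_lt
  refine eq_zero_of_forall_moment_eq_zero μ fun j => ?_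
  -- `‖m_j‖ ≤ p^{j-k-1-N}` for every `N`
  refine norm_eq_zero.mp (le_antisymm (le_of_forall_pos_lt_add fun ε hε => ?_) (norm_nonneg _))
  obtain ⟨N, hN⟩ := exists_pow_lt_of_lt_one hε (inv_lt_one_of_one_lt₀ hp1)
  calc ‖moment μ.1 j‖ ≤ (p : ℝ) ^ ((j : ℤ) - k - 1 - ((j + N : ℕ) : ℤ)) := norm_moment_le_of_mem_filG (h (j + N)) j
    _ ≤ (p : ℝ) ^ (-(N : ℤ)) := zpow_le_zpow_right₀ hp1.le (by push_cast; omega)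
    _ = ((p : ℝ)⁻¹) ^ N := by rw [zpow_neg, zpow_natCast, inv_pow]
    _ < ε := hN
    _ ≤ 0 + ε := (zero_add ε).ge

end Literature.NumberTheory.EllipticCurves

end
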